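import Summits.CriticalPhenomena.PercolationContinuityZ3.Theorems.PercNearOneGluingNoHeavyQuantGatedSliceMixLawA5rHolds
import Summits.CriticalPhenomena.PercolationContinuityZ3.Theorems.PercNearOneGluingNoHeavyQuantGatedSliceMixLawA5Assembly
import Summits.CriticalPhenomena.PercolationContinuityZ3.Theorems.PercNearOneGluingNoHeavyQuantGatedSliceMixLawAssemblyA
import HarnessLib

/-!
# QUANT lane R8, T-DEC, leg (III), blob case — `LawDec.GatedSliceMixLaw'`: cell A5 (the unsaturated-mid mixture) is a THEOREM, and the node
# from its three remaining residual cells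

builds on p205010 (kernel theorem, internal audit signed; external expert review pending)

Support file (`--supports stmt-CriticalPhenomena-4575`), QUANT lane seat prim-quant-arm-3 (gen 116), rung R8 of
`run/shared/lean/prim/quant/LADDER.md`.  Two one-line theorems, standard axioms, no sorries, no definitions: `mixLawCellA5r_holds`
(`…A5rHolds`, this seat) fed into the lead's `mixLawCellA5_of_residual` (`…A5Assembly`, lead g33), and the typer's node assembly
`gatedSliceMixLaw'_of_residualCells` (`…AssemblyA`) with the A5 antecedent discharged.

* **`LawDec.mixLawCellA5_holds : MixLawCellA5`**.
* `LawDec.gatedSliceMixLaw'_of_QcellsB : MixLawCellQ4 → MixLawCellQH → MixLawCellQK → MixLawRegimeB → GatedSliceMixLaw'`.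

HONEST STATUS: `MixLawCellQ4/QH/QK`, `MixLawRegimeB` (its cells BTwin, BTopBelow), `GatedSliceMixLaw'`, CW, `GateMove`, `SingleGateConvClosed`, `TreeDEC`,
`FarTreeRow` OPEN; RATE class log* / honest sentence unchanged.

[this work]; cell theorems: lead g33, typer g30, arm-2 g35/g36, census-2 g61, this seat.  The gluing rows served [cite: KozmaNitzan2024, Conjecture 3 (p. 15)];
product measure [cite: Grimmett1999, §1.3 p. 10].
-/

noncomputable section

namespace Summit.CriticalPhenomena.PercolationContinuityZ3.Theorems

namespace Quant

namespace LawDec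

/-- **CELL A5 IS A THEOREM** (`mixLawCellA5_of_residual` + `mixLawCellA5r_holds`). [this work] -/
theorem mixLawCellA5_holds : MixLawCellA5 :=
  mixLawCellA5_of_residual mixLawCellA5r_holds

/-- **The node `GatedSliceMixLaw'` from its three remaining cells** (`gatedSliceMixLaw'_of_residualCells` with A5 discharged):
`MixLawCellQ4 → MixLawCellQH → MixLawCellQK → MixLawRegimeB → GatedSliceMixLaw'`. [this work] -/
theorem gatedSliceMixLaw'_of_QcellsB (hQ4 : MixLawCellQ4) (hQH : MixLawCellQH) (hQK : MixLawCellQK) (hB : MixLawRegimeB) :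
    GatedSliceMixLaw' :=
  gatedSliceMixLaw'_of_residualCells mixLawCellA5_holds hQ4 hQH hQK hB

end LawDec

end Quant

end Summit.CriticalPhenomena.PercolationContinuityZ3.Theorems
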